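import Mathlib.GroupTheory.PGroup
import Mathlib.GroupTheory.SpecificGroups.Cyclic
import Mathlib.GroupTheory.Index
import Mathlib.Algebra.Group.Subgroup.Pointwise
import Mathlib.Data.ZMod.QuotientGroup
import HarnessLib

/-!
# Normal generators of a normal `p`-subgroup with cyclic-by-cyclic tame quotient (finite level)

A finite-group lemma in the spirit of K. Iwasawa, *On Galois groups of local fields*, Trans. AMS 80
(1955) and U. Jannsen, K. Wingberg, *Die Struktur der absoluten Galoisgruppe `p`-adischer
Zahlkörper*, Invent. Math. 70 (1982), §1 (the wild inertia group is finitely generated as a normal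
subgroup of the absolute Galois group): it is the uniform bound used to show, by compactness, that
the wild inertia group of a `p`-adic field is the topological normal closure of finitely many
elements (`Literature/GroupTheory/ProP/NormalGeneratorsProfinite.lean`).

Let `G` be a finite group generated by `g₁, …, g_d`, `P ⊴ G` a normal `p`-subgroup, and
`s, t ∈ G` with `t` of order prime to `p`, `s t s⁻¹ t^{-q} ∈ P` for some `q` prime to the order of
`t`, and `G = ⟨s, t⟩ P` (in the application: `s` a Frobenius, `t` a generator of tame inertia,
`q` the residue cardinality).

* `exists_le_sup_zpowers_of_conj_rel` — in a finite group `H = ⟨s, t⟩` with a normal `p`-subgroup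
  `Q`, `t` of order prime to `p` and `s t s⁻¹ t^{-q} ∈ Q₀ ⊴ H`, `Q₀ ≤ Q`: the `p`-group `Q / Q₀`
  embeds in the cyclic group `H / Q₀⟨t⟩`, so `Q ≤ Q₀ ⊔ ⟨x⟩` for one `x ∈ Q`;
* `exists_normalClosure_eq_of_conj_rel` — consequently `P` is the normal closure of `d + 2`
  elements of `P`: the `P`-components `pᵢ` of `gᵢ = hᵢ pᵢ` (`hᵢ ∈ ⟨s, t⟩`), `w = s t s⁻¹ t^{-q}`,
  and `x`.

Pure finite group theory over Mathlib; proof-only (no definitions).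
[cite: JannsenWingberg1982, §1] [cite: NeukirchSchmidtWingberg2008, Thm. 7.5.3]
-/

namespace Literature.GroupTheory

open Subgroup

universe u

section Cyclic

variable {H : Type u} [Group H]

/-- If `s t s⁻¹ = t ^ q` with `t` of finite order, conjugation by `s` maps `⟨t⟩` onto itself (the
shape of the tame relation `σ τ σ⁻¹ = τ^q`). [cite: NeukirchSchmidtWingberg2008, Thm. 7.5.3]
[cite: JannsenWingberg1982, §1] -/
theorem map_conj_zpowers_eq_of_conj_eq_pow {s t : H} (ht : IsOfFinOrder t) {q : ℕ}
    (hrel : s * t * s⁻¹ = t ^ q) :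
    (Subgroup.zpowers t).map (MulAut.conj s).toMonoidHom = Subgroup.zpowers t := by
  haveI : Finite (Subgroup.zpowers t) := ht.finite_zpowers
  have hle : (Subgroup.zpowers t).map (MulAut.conj s).toMonoidHom ≤ Subgroup.zpowers t := by
    rw [MonoidHom.map_zpowers, Subgroup.zpowers_le, MulEquiv.coe_toMonoidHom, MulAut.conj_apply, hrel]
    exact Subgroup.pow_mem _ (Subgroup.mem_zpowers t) q
  refine Subgroup.eq_of_le_of_card_ge hle (le_of_eq ?_)
  exact (Subgroup.card_map_of_injective (MulAut.conj s).injective).symm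

/-- In a group generated by `s, t`, if `s t s⁻¹ = t ^ q` with `t` of finite order, then `⟨t⟩` is
normal (finite quotients of the tame Galois group `⟨σ, τ | σ τ σ⁻¹ = τ^q⟩`).
[cite: NeukirchSchmidtWingberg2008, Thm. 7.5.3] [cite: JannsenWingberg1982, §1] -/
theorem zpowers_normal_of_conj_eq_pow {s t : H} (hst : Subgroup.closure ({s, t} : Set H) = ⊤)
    (ht : IsOfFinOrder t) {q : ℕ} (hrel : s * t * s⁻¹ = t ^ q) :
    (Subgroup.zpowers t).Normal := by
  have hmap := map_conj_zpowers_eq_of_conj_eq_pow ht hrel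
  -- both conjugations by `s` preserve `⟨t⟩`
  have hs1 : ∀ x ∈ Subgroup.zpowers t, s * x * s⁻¹ ∈ Subgroup.zpowers t := by
    intro x hx
    have : s * x * s⁻¹ ∈ (Subgroup.zpowers t).map (MulAut.conj s).toMonoidHom :=
      Subgroup.mem_map_of_mem _ hx
    rwa [hmap] at this
  have hs2 : ∀ x ∈ Subgroup.zpowers t, s⁻¹ * x * s⁻¹⁻¹ ∈ Subgroup.zpowers t := by
    intro x hx
    rw [← hmap] at hx
    obtain ⟨y, hy, hyx⟩ := Subgroup.mem_map.mp hx
    rw [MulEquiv.coe_toMonoidHom, MulAut.conj_apply] at hyx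
    rw [← hyx, inv_inv]
    simpa [mul_assoc] using hy
  -- induction over the generators
  refine ⟨fun x hx g => ?_⟩
  have hg : g ∈ Subgroup.closure ({s, t} : Set H) := by rw [hst]; exact Subgroup.mem_top g
  revert x
  induction hg using Subgroup.closure_induction with
  | mem a ha =>
    intro x hx
    rcases ha with rfl | ha
    · exact hs1 x hx
    · rw [Set.mem_singleton_iff] at ha
      subst ha
      exact mul_mem (mul_mem (Subgroup.mem_zpowers _) hx) (inv_mem (Subgroup.mem_zpowers _))
  | one => intro x hx; simpa using hx
  | mul a b _ _ ha hb =>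
    intro x hx
    have : a * b * x * (a * b)⁻¹ = a * (b * x * b⁻¹) * a⁻¹ := by group
    rw [this]
    exact ha _ (hb _ hx)
  | inv a ha' ha =>
    intro x hx
    -- `a` is in the closure, so it normalises; for the inverse use the generators case analysis via
    -- the already established two-sided statement for `s` and the trivial one for `t`.
    -- We prove the two-sided statement uniformly by a second induction.
    have key : ∀ c ∈ Subgroup.closure ({s, t} : Set H), ∀ x ∈ Subgroup.zpowers t,
        c * x * c⁻¹ ∈ Subgroup.zpowers t ∧ c⁻¹ * x * c⁻¹⁻¹ ∈ Subgroup.zpowers t := by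
      intro c hc
      induction hc using Subgroup.closure_induction with
      | mem a ha =>
        intro x hx
        rcases ha with rfl | ha
        · exact ⟨hs1 x hx, hs2 x hx⟩
        · rw [Set.mem_singleton_iff] at ha
          subst ha
          exact ⟨mul_mem (mul_mem (Subgroup.mem_zpowers _) hx) (inv_mem (Subgroup.mem_zpowers _)),
            mul_mem (mul_mem (inv_mem (Subgroup.mem_zpowers _)) hx)
              (inv_mem (inv_mem (Subgroup.mem_zpowers _)))⟩
      | one => intro x hx; constructor <;> simpa using hx
      | mul a b _ _ ha hb =>
        intro x hx
        constructor
        · have : a * b * x * (a * b)⁻¹ = a * (b * x * b⁻¹) * a⁻¹ := by group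
          rw [this]; exact (ha _ (hb _ hx).1).1
        · have : (a * b)⁻¹ * x * (a * b)⁻¹⁻¹ = b⁻¹ * (a⁻¹ * x * a⁻¹⁻¹) * b⁻¹⁻¹ := by group
          rw [this]; exact (hb _ (ha _ hx).2).2
      | inv a _ ha =>
        intro x hx
        exact ⟨(ha x hx).2, by simpa using (ha x hx).1⟩
    exact (key a ha' x hx).2

variable [Finite H]

/-- **The `p`-part of a `(p'‑cyclic)`-by-cyclic quotient is cyclic.**  Let `H = ⟨s, t⟩` be finite,
`Q₀, Q` normal subgroups with `Q` a `p`-group, `t` of order prime to `p`, and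
`s t s⁻¹ t^{-q} ∈ Q₀` with `q` prime to the order of `t`.  Then `Q ≤ Q₀ ⊔ ⟨x⟩` for some `x ∈ Q`
(`Q / Q₀` embeds in the cyclic group `(H / Q₀) / ⟨t⟩`).
[cite: JannsenWingberg1982, §1] [cite: NeukirchSchmidtWingberg2008, Thm. 7.5.3] -/
theorem exists_le_sup_zpowers_of_conj_rel {p : ℕ} [hp : Fact p.Prime] {s t : H}
    (hst : Subgroup.closure ({s, t} : Set H) = ⊤) {Q₀ Q : Subgroup H} [Q₀.Normal] [Q.Normal]
    (hQ : IsPGroup p Q) (ht : (orderOf t).Coprime p) {q : ℕ}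
    (hrel : s * t * s⁻¹ * (t ^ q)⁻¹ ∈ Q₀) :
    ∃ x ∈ Q, Q ≤ Q₀ ⊔ Subgroup.zpowers x := by
  classical
  -- pass to `H' = H ⧸ Q₀`
  set π := QuotientGroup.mk' Q₀ with hπ
  set s' := π s
  set t' := π t
  have hrel' : s' * t' * s'⁻¹ = t' ^ q := by
    rw [← mul_inv_eq_one, ← map_pow, ← map_mul, ← map_inv, ← map_mul, ← map_inv, ← map_mul, hπ,
      QuotientGroup.mk'_apply, QuotientGroup.eq_one_iff]
    exact hrel
  have hdvd : orderOf t' ∣ orderOf t := orderOf_map_dvd π t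
  have ht' : (orderOf t').Coprime p := Nat.Coprime.coprime_dvd_left hdvd ht
  have hst' : Subgroup.closure ({s', t'} : Set (H ⧸ Q₀)) = ⊤ := by
    have := congrArg (Subgroup.map π) hst
    rw [MonoidHom.map_closure, Set.image_pair, Subgroup.map_top_of_surjective π
      (QuotientGroup.mk'_surjective Q₀)] at this
    exact this
  -- `T = ⟨t'⟩` is normal, of order prime to `p`
  set T : Subgroup (H ⧸ Q₀) := Subgroup.zpowers t' with hT
  haveI hTN : T.Normal := zpowers_normal_of_conj_eq_pow hst' (isOfFinOrder_of_finite t') hrel'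
  -- `Q' = π(Q)` is a `p`-group meeting `T` trivially
  set Q' : Subgroup (H ⧸ Q₀) := Q.map π with hQ'
  have hQ'p : IsPGroup p Q' := hQ.map π
  have hdisj : Disjoint T Q' := by
    obtain ⟨k, hk⟩ := IsPGroup.iff_card.mp hQ'p
    refine Subgroup.disjoint_of_coprime_natCard ?_
    rw [hk, hT, Nat.card_zpowers]
    exact Nat.Coprime.pow_right k ht'
  -- `H' ⧸ T` is cyclic, generated by the image of `s'`
  set ψ := QuotientGroup.mk' T with hψ
  haveI : IsCyclic ((H ⧸ Q₀) ⧸ T) := by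
    refine isCyclic_iff_exists_zpowers_eq_top.mpr ⟨ψ s', ?_⟩
    have h1 : ψ t' = 1 := by
      rw [hψ, QuotientGroup.mk'_apply, QuotientGroup.eq_one_iff]; exact Subgroup.mem_zpowers t'
    have := congrArg (Subgroup.map ψ) hst'
    rw [MonoidHom.map_closure, Set.image_pair, h1, Set.pair_comm, Subgroup.closure_insert_one,
      Subgroup.map_top_of_surjective ψ (QuotientGroup.mk'_surjective T)] at this
    rw [← Subgroup.zpowers_eq_closure] at this
    exact this
  -- `Q'` embeds in `H' ⧸ T`, hence is cyclic
  have hinj : Function.Injective (ψ.restrict Q') := by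
    rw [← MonoidHom.ker_eq_bot_iff, MonoidHom.ker_restrict, hψ, QuotientGroup.ker_mk',
      Subgroup.subgroupOf_eq_bot]
    exact hdisj
  haveI : IsCyclic Q' := isCyclic_of_injective _ hinj
  obtain ⟨⟨x', hx'⟩, hgen⟩ := IsCyclic.exists_generator (α := Q')
  obtain ⟨x, hx, rfl⟩ := Subgroup.mem_map.mp hx'
  refine ⟨x, hx, fun y hy => ?_⟩
  have hy' : π y ∈ Q' := Subgroup.mem_map_of_mem π hy
  obtain ⟨k, hk⟩ := Subgroup.mem_zpowers_iff.mp (hgen ⟨π y, hy'⟩)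
  have hk' : π x ^ k = π y := by
    have := congrArg Subtype.val hk
    simpa using this
  -- `y = (y x^{-k}) x^k` with `y x^{-k} ∈ Q₀`
  have hmem : y * (x ^ k)⁻¹ ∈ Q₀ := by
    rw [← QuotientGroup.eq_one_iff, ← QuotientGroup.mk'_apply, ← hπ, map_mul, map_inv, map_zpow, hk',
      mul_inv_cancel]
  have : y = y * (x ^ k)⁻¹ * x ^ k := by rw [inv_mul_cancel_right]
  rw [this]
  exact Subgroup.mul_mem_sup hmem (Subgroup.zpow_mem _ (Subgroup.mem_zpowers x) k)

end Cyclic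

section Assembly

variable {G : Type u} [Group G] [Finite G]

/-- **Normal generation by `d + 2` elements.**  Let `G` be finite, generated by `g₁, …, g_d`; let
`P ⊴ G` be a normal `p`-subgroup and `s, t ∈ G` with `t` of order prime to `p`,
`w = s t s⁻¹ t^{-q} ∈ P` for some `q` prime to the order of `t`, and `⟨s, t⟩ P = G`.  Then `P` is the
normal closure of `d + 2` of its elements. [cite: JannsenWingberg1982, §1]
[cite: NeukirchSchmidtWingberg2008, Thm. 7.5.3] -/
theorem exists_normalClosure_eq_of_conj_rel {p : ℕ} [hp : Fact p.Prime] {d : ℕ} {g : Fin d → G}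
    (hg : Subgroup.closure (Set.range g) = ⊤) {P : Subgroup G} [P.Normal] (hP : IsPGroup p P)
    {s t : G} (ht : (orderOf t).Coprime p) {q : ℕ}
    (hrel : s * t * s⁻¹ * (t ^ q)⁻¹ ∈ P) (hgen : Subgroup.closure ({s, t} : Set G) ⊔ P = ⊤) :
    ∃ y : Fin (d + 2) → G, (∀ a, y a ∈ P) ∧ Subgroup.normalClosure (Set.range y) = P := by
  classical
  set K : Subgroup G := Subgroup.closure ({s, t} : Set G) with hK
  -- `gᵢ = hᵢ pᵢ`
  have hdec : ∀ i, ∃ h ∈ K, ∃ c ∈ P, h * c = g i := fun i =>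
    Subgroup.mem_sup_of_normal_right.mp (by rw [hgen]; exact Subgroup.mem_top (g i))
  choose h hh c hc hhc using hdec
  -- the element `w`
  set w : G := s * t * s⁻¹ * (t ^ q)⁻¹ with hw
  have hsK : s ∈ K := Subgroup.subset_closure (Set.mem_insert s {t})
  have htK : t ∈ K := Subgroup.subset_closure (Set.mem_insert_of_mem s rfl)
  have hwK : w ∈ K := mul_mem (mul_mem (mul_mem hsK htK) (inv_mem hsK)) (inv_mem (pow_mem htK q))
  -- inside the group `K`: `Q = P ∩ K`, `Q₀` = normal closure of `w`
  set sK : K := ⟨s, hsK⟩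
  set tK : K := ⟨t, htK⟩
  set Q : Subgroup K := P.subgroupOf K with hQ
  haveI : Q.Normal := by rw [hQ]; infer_instance
  set Q₀ : Subgroup K := Subgroup.normalClosure ({⟨w, hwK⟩} : Set K) with hQ₀
  have hQp : IsPGroup p Q := by
    rw [hQ]
    exact hP.comap_of_injective K.subtype Subtype.coe_injective |>.of_equiv
      (MulEquiv.refl _)
  have htK' : (orderOf tK).Coprime p := by rw [Subgroup.orderOf_mk]; exact ht
  have hrelK : sK * tK * sK⁻¹ * (tK ^ q)⁻¹ ∈ Q₀ :=
    Subgroup.subset_normalClosure (Set.mem_singleton_iff.mpr (Subtype.ext rfl))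
  have hstK : Subgroup.closure ({sK, tK} : Set K) = ⊤ := by
    have := Subgroup.closure_closure_coe_preimage (k := ({s, t} : Set G))
    convert this using 2
    ext ⟨x, hx⟩
    simp only [Set.mem_insert_iff, Set.mem_singleton_iff, Set.mem_preimage, Subtype.ext_iff, sK, tK]
  obtain ⟨xK, hxK, hle⟩ := exists_le_sup_zpowers_of_conj_rel (p := p) hstK hQp htK' hrelK
  have hxP : (xK : G) ∈ P := Subgroup.mem_subgroupOf.mp hxK
  -- the `d + 2` normal generators `x, w, c₁, …, c_d`
  set y : Fin (d + 2) → G := Fin.cons (xK : G) (Fin.cons w c) with hy_def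
  have hy0 : y 0 = (xK : G) := rfl
  have hy1 : y 1 = w := rfl
  have hyss : ∀ i : Fin d, y i.succ.succ = c i := fun i => rfl
  have hyP : ∀ a, y a ∈ P := by
    intro a
    refine Fin.cases ?_ (fun a => ?_) a
    · rw [hy0]; exact hxP
    · refine Fin.cases ?_ (fun a => ?_) a
      · exact hrel
      · exact hc a
  refine ⟨y, hyP, ?_⟩
  set N : Subgroup G := Subgroup.normalClosure (Set.range y) with hN
  apply le_antisymm
  · exact Subgroup.normalClosure_le_normal (by rintro _ ⟨a, rfl⟩; exact hyP a)
  · -- generators lie in `N`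
    have hcN : ∀ i, c i ∈ N := fun i => Subgroup.subset_normalClosure ⟨i.succ.succ, hyss i⟩
    have hwN : w ∈ N := Subgroup.subset_normalClosure ⟨1, hy1⟩
    have hxN : (xK : G) ∈ N := Subgroup.subset_normalClosure ⟨0, hy0⟩
    -- `G = K ⊔ N`
    have hKN : K ⊔ N = ⊤ := by
      rw [eq_top_iff, ← hg, Subgroup.closure_le]
      rintro _ ⟨i, rfl⟩
      rw [SetLike.mem_coe, ← hhc i]
      exact Subgroup.mul_mem_sup (hh i) (hcN i)
    -- `Q ≤ N`: `Q ≤ Q₀ ⊔ ⟨xK⟩` and both map into `N`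
    have hQ₀N : Q₀.map K.subtype ≤ N := by
      rw [hQ₀, Subgroup.map_le_iff_le_comap]
      refine Subgroup.normalClosure_le_normal (N := N.comap K.subtype) ?_
      rintro _ ⟨rfl⟩
      exact hwN
    have hQN : ∀ z : K, z ∈ Q → (z : G) ∈ N := by
      intro z hz
      rcases Subgroup.mem_sup_of_normal_left.mp (hle hz) with ⟨a, ha, b, hb, hab⟩
      rw [← hab, Subgroup.coe_mul]
      refine mul_mem (hQ₀N ⟨a, ha, rfl⟩) ?_
      obtain ⟨k, rfl⟩ := Subgroup.mem_zpowers_iff.mp hb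
      rw [SubgroupClass.coe_zpow]
      exact Subgroup.zpow_mem _ hxN k
    have hNP : N ≤ P := Subgroup.normalClosure_le_normal (by rintro _ ⟨a, rfl⟩; exact hyP a)
    -- conclude
    intro z hz
    obtain ⟨k, hk, m, hm, rfl⟩ := Subgroup.mem_sup_of_normal_right.mp
      (show z ∈ K ⊔ N by rw [hKN]; exact Subgroup.mem_top z)
    have hkP : k ∈ P := by
      have : k = (k * m) * m⁻¹ := by rw [mul_inv_cancel_right]
      rw [this]; exact mul_mem hz (inv_mem (hNP hm))
    have hkQ : (⟨k, hk⟩ : K) ∈ Q := Subgroup.mem_subgroupOf.mpr hkP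
    exact mul_mem (hQN _ hkQ) hm

end Assembly

end Literature.GroupTheory
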